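import Summits.ResolutionOfSingularities.ResolutionOfSingularities.Theorems.FrobeniusClosingPatchingRelPerfectConeDepthLadderStep
import Summits.ResolutionOfSingularities.ResolutionOfSingularities.Theorems.FrobeniusClosingPatchingRelPerfectTowerContraction
import Summits.ResolutionOfSingularities.ResolutionOfSingularities.Theorems.FrobeniusClosingPatchingRelPerfectCoreRungClosure
import Summits.ResolutionOfSingularities.ResolutionOfSingularities.Theorems.FrobeniusClosingPatchingRelPerfectCoreRungReductions
import HarnessLib

/-!
# Crux `PatchingRelPerfect` (stmt-ResolutionOfSingularities-16161), chain W5.2 — rung «r-cone-ℓ», the LADDER III: the foot,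
# the climb, and the rung modulo the vertex fibre theorem

[OURS · L1 W5.2 · rung tool] Replaces the role of NO printed item; NOT a statement of the manuscript under review; fact-free.
AI-written (AI review is weaker than expert review).

* `coneEndCompanion`, `LadderState.companion_of_zero`, `LadderState.companion` — THE CLIMB in companion form (`I ∈ 𝒞`: an
  `𝔪`-primary companion `Q` with `Bl_{I·Q} Spec S` regular): by strong induction on the vertex exponent `b`, every state gives a
  companion (`step` fed with `blowup.π 𝓘_{{z}}` and the vertex fibre theorem, `b - min (a+2) b < b`; at `b = 0` the END,
  contracted by `towerContraction`);
* `LadderState.initial` — THE FOOT: for `S` regular local with regular system of parameters `x₀, …, x₃` and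
  `I = (x₀x₁ + x₂²) + 𝔪^{ℓ+2}`, the blowing up `X₁ = Bl_𝔪 Spec S` carries a state with exponents `(0, ℓ)`
  (`I𝒪_{X₁} = 𝓘_{E₁}² (𝓗₁ ⊔ 𝓘_{E₁}^ℓ)`; the vertex fibre theorem applied to `Spec S` at its closed point, `𝒪_{Spec S,𝔪} = S_𝔪`,
  regular system `(x₃, x₀, x₁, x₂)` with `x₃` a dummy carrier);
* `companion_cone_sup_pow_of`, `coreRung_cone_sup_pow_of`, `coreRung_powersPlus_cone_of` — the rung for every `ℓ` (companion
  form, blow-up form via `atomConclusion_of_companion'`, and the sup-reduced member `(x_i^{ℓ+2}, q)` via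
  `coreRung_sup_reduction_of_companion`), modulo the vertex fibre theorem (hypothesis `hVF`, discharged in `…ConeDepthLadderRung`
  by `ConeDepth.vertex_fibre`).
-/

set_option linter.dupNamespace false

noncomputable section

open CategoryTheory CategoryTheory.Limits AlgebraicGeometry TopologicalSpace IsLocalRing
open Literature.AlgebraicGeometry.Resolution
open Scheme.IdealSheafData

namespace Summit.ResolutionOfSingularities.ResolutionOfSingularities.Theorems

universe u

namespace ConeDepth

/-! ## §5 Climbing the ladder: induction on the vertex exponent (companion form) -/

/-- **THE END in companion form**: under the hypotheses of `coneEnd`, `I` has an `𝔪`-primary companion `Q ⊇ 𝔪^m` with a REGULAR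
blowing up of `Spec S` along `(I·Q)~` (the pair game's tower contracted by `towerContraction`). [cite: StacksProject, Tag 080A] -/
theorem coneEndCompanion {S : Type u} [CommRing S] [IsRegularLocalRing S] {I : Ideal S} (hI : I ≠ ⊥)
    {X : Scheme.{u}} [IsNoetherian X] (hX : Scheme.IsRegular X) {g : X ⟶ Spec (.of S)}
    (hg : ∃ K₀ : (Spec (.of S)).IdealSheafData, IsBlowup g K₀ ∧
      (K₀.support : Set (Spec (.of S))) ⊆ {IsLocalRing.closedPoint S})
    {M : X.IdealSheafData} (hM : IsLocallyPrincipal M) (A B : List (X.IdealSheafData × ℕ))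
    (hAB : boundaryOf A = boundaryOf B)
    (hsnc : ∀ x : X, x ∈ (monomialIdeal A ⊔ monomialIdeal B).support → DepthSNC.SNCWithAt (boundaryOf A) ⊤ x)
    (hsupp : ((monomialIdeal A ⊔ monomialIdeal B).support : Set X) ⊆ g ⁻¹' {IsLocalRing.closedPoint S})
    (hfmt : (affineBlowup.idealSheaf I).comap g = M * (monomialIdeal A ⊔ monomialIdeal B)) :
    ∃ (Q : Ideal S) (m : ℕ), IsLocalRing.maximalIdeal S ^ m ≤ Q ∧
      ∃ (B' : Scheme.{u}) (b : B' ⟶ Spec (.of S)),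
        IsBlowup b (affineBlowup.idealSheaf (I * Q)) ∧ Scheme.IsRegular B' := by
  obtain ⟨s, -, hover, htop, hlp⟩ := DepthTargets.pointwisePairGame_holds X hX A B hAB hsnc
  obtain ⟨Q, hQ, hQT⟩ := MonomialCleanup.centreSeq_exists_isBlowup_comp_supported s g
    {IsLocalRing.closedPoint S} hg (CentreSeq.CentresOver.mono s hsupp hover)
  refine towerContraction I hI _ (s.comp ≫ g) Q hQ hQT htop ?_
  rw [Scheme.IdealSheafData.comap_comp, hfmt, comap_mul]
  exact (hM.comap s.comp).mul hlp

section Climb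

variable {S : Type u} [CommRing S] [IsRegularLocalRing S] {I : Ideal S}

-- The VERTEX FIBRE THEOREM as a hypothesis (the statement of `ConeDepth.vertex_fibre`, discharged in `…ConeDepthLadderRung`).
variable (hVF : ∀ {X' X : Scheme.{u}} {σ : X' ⟶ X} {J : X.IdealSheafData} (_ : IsBlowup σ J) (z : X)
    (c : Fin 4 → X.presheaf.stalk z) [IsRegularLocalRing (X.presheaf.stalk z)]
    (_ : Ideal.span (Set.range c) = maximalIdeal (X.presheaf.stalk z))
    (_ : (maximalIdeal (X.presheaf.stalk z)).spanFinrank = 4)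
    (_ : stalkIdeal J z = maximalIdeal (X.presheaf.stalk z)) (𝓗 G : X.IdealSheafData)
    (_ : stalkIdeal 𝓗 z = Ideal.span {c 1 * c 2 + c 3 ^ 2}) (_ : stalkIdeal G z = Ideal.span {c 0}),
    ∃ z' : X', σ z' = z ∧
      (∃ c' : Fin 4 → X'.presheaf.stalk z',
        IsRegularLocalRing (X'.presheaf.stalk z') ∧ Ideal.span (Set.range c') = maximalIdeal _ ∧
        (maximalIdeal (X'.presheaf.stalk z')).spanFinrank = 4 ∧
        stalkIdeal (J.comap σ) z' = Ideal.span {c' 0} ∧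
        stalkIdeal (controlledTransform σ J 𝓗 2) z' = Ideal.span {c' 1 * c' 2 + c' 3 ^ 2} ∧
        stalkIdeal (controlledTransform σ J G 1) z' = ⊤) ∧
      ∀ x' : X', σ x' = z → x' ≠ z' →
        DepthSNC.SNCWithAt [controlledTransform σ J 𝓗 2, J.comap σ, controlledTransform σ J G 1] ⊤ x')

namespace LadderState

/-- **The END applies at exponent `b = 0`, companion form.** [cite: Kollar2007, (3.111) Step 3] [cite: StacksProject, Tag 080A] -/
theorem companion_of_zero {X : Scheme.{u}} {g : X ⟶ Spec (.of S)} {M 𝓗 E : X.IdealSheafData}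
    {A B : List (X.IdealSheafData × ℕ)} {a : ℕ} {z : X} (h : LadderState I X g M 𝓗 E A B a 0 z) (hI : I ≠ ⊥)
    (hIm : ((affineBlowup.idealSheaf I).support : Set (Spec (.of S))) ⊆ {IsLocalRing.closedPoint S}) :
    ∃ (Q : Ideal S) (m : ℕ), IsLocalRing.maximalIdeal S ^ m ≤ Q ∧
      ∃ (B' : Scheme.{u}) (b : B' ⟶ Spec (.of S)),
        IsBlowup b (affineBlowup.idealSheaf (I * Q)) ∧ Scheme.IsRegular B' := by
  haveI := h.isNoetherian
  have hK : 𝓗 * monomialIdeal (A ++ [(E, a)]) ⊔ monomialIdeal (B ++ [(E, 0)]) =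
      monomialIdeal ((𝓗, 1) :: (A ++ [(E, a)])) ⊔ monomialIdeal ((𝓗, 0) :: (B ++ [(E, 0)])) := by
    rw [monomialIdeal_cons, monomialIdeal_cons, pow_one, pow_zero, Scheme.IdealSheafData.one_eq_top,
      Scheme.IdealSheafData.top_mul]
  have hfmt := h.format
  rw [hK] at hfmt
  have hover : ∀ x : X, x ∈ (monomialIdeal ((𝓗, 1) :: (A ++ [(E, a)])) ⊔ monomialIdeal ((𝓗, 0) :: (B ++ [(E, 0)]))).support →
      g x = IsLocalRing.closedPoint S := by
    intro x hx
    have hxI : x ∈ ((affineBlowup.idealSheaf I).comap g).support := by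
      rw [hfmt, Scheme.IdealSheafData.support_mul]
      exact Or.inr hx
    rw [Scheme.IdealSheafData.support_comap] at hxI
    exact hIm hxI
  refine coneEndCompanion hI h.isRegular h.exists_isBlowup h.isLocallyPrincipal _ _ ?_ ?_ hover hfmt
  · show 𝓗 :: boundaryOf (A ++ [(E, a)]) = 𝓗 :: boundaryOf (B ++ [(E, 0)])
    rw [boundaryOf_append, boundaryOf_append, h.boundaryOf_eq]
    rfl
  · intro x hx
    have hxz : x ≠ z := by
      rintro rfl
      rw [← hK] at hx
      have hB : stalkIdeal (monomialIdeal (B ++ [(E, 0)])) x = ⊤ := by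
        rw [stalkIdeal_monomialIdeal, List.map_append, List.prod_append, List.map_singleton, List.prod_singleton,
          pow_zero, mul_one, ← Ideal.one_eq_top]
        refine List.prod_eq_one fun J hJ => ?_
        obtain ⟨p, hp, rfl⟩ := List.mem_map.mp hJ
        have hD : x ∉ p.1.support := h.not_mem_support p.1 (h.boundaryOf_eq ▸ fst_mem_boundaryOf hp)
        rw [stalkIdeal_eq_top_of_not_mem_support hD, Ideal.top_pow, Ideal.one_eq_top]
      rw [mem_support_iff_stalkIdeal_ne_top, stalkIdeal_sup, hB] at hx
      exact hx (sup_top_eq _)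
    have := h.snc x (hover x hx) hxz
    show DepthSNC.SNCWithAt (𝓗 :: boundaryOf (A ++ [(E, a)])) ⊤ x
    rwa [boundaryOf_append]

include hVF in
/-- **THE LADDER (companion form).**  Assume the VERTEX FIBRE THEOREM (hypothesis `hVF`, the statement of
`ConeDepth.vertex_fibre`).  Then every state of the ladder gives `I` an `𝔪`-primary companion with a regular blowing up: strong
induction on the vertex exponent `b` — at `b = 0` the END (`companion_of_zero`); otherwise blow up the vertex (`blowup.π 𝓘_z`),
feed the vertex fibre theorem to `step`, and note `b - min (a+2) b < b`. [cite: Kollar2007, 3.61 and (3.111) Step 3]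
[cite: StacksProject, Tag 080A] -/
theorem companion (hI : I ≠ ⊥) (hIm : ((affineBlowup.idealSheaf I).support : Set (Spec (.of S))) ⊆ {IsLocalRing.closedPoint S})
    (b : ℕ) :
    ∀ {X : Scheme.{u}} {g : X ⟶ Spec (.of S)} {M 𝓗 E : X.IdealSheafData} {A B : List (X.IdealSheafData × ℕ)}
      {a : ℕ} {z : X}, LadderState I X g M 𝓗 E A B a b z →
      ∃ (Q : Ideal S) (m : ℕ), IsLocalRing.maximalIdeal S ^ m ≤ Q ∧
        ∃ (B' : Scheme.{u}) (b : B' ⟶ Spec (.of S)),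
          IsBlowup b (affineBlowup.idealSheaf (I * Q)) ∧ Scheme.IsRegular B' := by
  induction b using Nat.strong_induction_on with
  | _ b ih =>
    intro X g M 𝓗 E A B a z h
    rcases Nat.eq_zero_or_pos b with rfl | hb
    · exact h.companion_of_zero hI hIm
    · -- blow up the vertex
      obtain ⟨c, hreg, hc, hd, h𝓗, hE⟩ := h.vertex
      haveI := hreg
      have hσ := blowup.isBlowup (vanishingIdeal (⟨{z}, h.isClosed⟩ : Closeds X))
      have hfib := hVF hσ z c hc hd (stalkIdeal_vanishingIdeal_singleton h.isClosed) 𝓗 E h𝓗 hE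
      obtain ⟨z', h'⟩ := h.step hσ hfib
      have hlt : b - min (a + 2) b < b := by omega
      exact ih _ hlt h'

end LadderState

/-! ## §6 The foot of the ladder: the first blowing up of `Spec S` -/

namespace LadderState

include hVF in
/-- **THE FOOT OF THE LADDER.**  For `S` regular local with a regular system of parameters `x₀, …, x₃` (spanning `𝔪`, `μ(𝔪) = 4`)
and `I = (x₀x₁ + x₂²) + 𝔪^{ℓ+2}`, the blowing up `σ₁ : X₁ = Bl_𝔪 Spec S → Spec S` carries a state of the ladder with vertex
exponents `(0, ℓ)`: `I𝒪_{X₁} = 𝓘_{E₁}² · (𝓗₁ ⊔ 𝓘_{E₁}^ℓ)` with `𝓗₁ = σ₁ᶜ((q)~, 2)` the strict transform of the cone and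
`E₁` the exceptional divisor; the vertex `z₁` and the simple normal crossings off it come from the VERTEX FIBRE THEOREM applied to
`Spec S` at its closed point with the regular system `(x₃, x₀, x₁, x₂)` of `𝒪_{Spec S, 𝔪} = S` (`x₃` a dummy carrier).
[cite: Kollar2007, 3.61] [cite: Liu2002, Thm. 8.1.19 (a)] [cite: Hartshorne1977, II Prop. 5.1 (b)] -/
theorem initial (x : Fin 4 → S) (hx : Ideal.span (Set.range x) = maximalIdeal S) (hd : (maximalIdeal S).spanFinrank = 4) (ℓ : ℕ) :
    ∃ z₁ : blowup (affineBlowup.idealSheaf (maximalIdeal S)),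
      LadderState (Ideal.span {x 0 * x 1 + x 2 ^ 2} ⊔ maximalIdeal S ^ (ℓ + 2))
        (blowup (affineBlowup.idealSheaf (maximalIdeal S))) (blowup.π (affineBlowup.idealSheaf (maximalIdeal S)))
        ((affineBlowup.idealSheaf (maximalIdeal S)).comap (blowup.π (affineBlowup.idealSheaf (maximalIdeal S))) ^ 2)
        (controlledTransform (blowup.π (affineBlowup.idealSheaf (maximalIdeal S))) (affineBlowup.idealSheaf (maximalIdeal S))
          (affineBlowup.idealSheaf (Ideal.span {x 0 * x 1 + x 2 ^ 2})) 2)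
        ((affineBlowup.idealSheaf (maximalIdeal S)).comap (blowup.π (affineBlowup.idealSheaf (maximalIdeal S))))
        [] [] 0 ℓ z₁ := by
  classical
  set J₀ : (Spec (.of S)).IdealSheafData := affineBlowup.idealSheaf (maximalIdeal S) with hJ₀
  set σ := blowup.π J₀ with hσdef
  have hσ : IsBlowup σ J₀ := blowup.isBlowup J₀
  set Hq : (Spec (.of S)).IdealSheafData := affineBlowup.idealSheaf (Ideal.span {x 0 * x 1 + x 2 ^ 2}) with hHq
  set G₀ : (Spec (.of S)).IdealSheafData := affineBlowup.idealSheaf (Ideal.span {x 3}) with hG₀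
  haveI : IsDomain S := isDomain_of_isRegularLocalRing S
  haveI : IsRegularRing S := isRegularRing_of_isRegularLocalRing S
  haveI : IsIntegral (Spec (.of S)) := inferInstanceAs (IsIntegral (Spec (CommRingCat.of S)))
  -- the closed point and its local ring `𝒪_{Spec S, 𝔪} = S`
  let z₀ : Spec (.of S) := IsLocalRing.closedPoint S
  have hz₀ : IsClosed ({z₀} : Set (Spec (.of S))) :=
    (PrimeSpectrum.isClosed_singleton_iff_isMaximal _).mpr (IsLocalRing.maximalIdeal.isMaximal S)
  letI : Algebra S ((Spec (.of S)).presheaf.stalk z₀) :=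
    inferInstanceAs (Algebra S ((Spec.structureSheaf S).presheaf.stalk z₀))
  haveI : IsLocalization.AtPrime ((Spec (.of S)).presheaf.stalk z₀) (maximalIdeal S) :=
    inferInstanceAs (IsLocalization.AtPrime ((Spec.structureSheaf S).presheaf.stalk z₀) z₀.asIdeal)
  haveI hregA : IsRegularLocalRing ((Spec (.of S)).presheaf.stalk z₀) := Scheme.isRegular_Spec (.of S) z₀
  have hmaxA : maximalIdeal ((Spec (.of S)).presheaf.stalk z₀) =
      (maximalIdeal S).map (algebraMap S ((Spec (.of S)).presheaf.stalk z₀)) :=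
    (IsLocalization.AtPrime.map_eq_maximalIdeal (maximalIdeal S) _).symm
  have hdimS : ringKrullDim S = (4 : ℕ) := by rw [← IsRegularLocalRing.spanFinrank_maximalIdeal, hd]
  have hdimA : ringKrullDim ((Spec (.of S)).presheaf.stalk z₀) = (4 : ℕ) := by
    rw [IsLocalization.AtPrime.ringKrullDim_eq_height (maximalIdeal S) ((Spec (.of S)).presheaf.stalk z₀),
      IsLocalRing.maximalIdeal_height_eq_ringKrullDim, hdimS]
  have hdA : (maximalIdeal ((Spec (.of S)).presheaf.stalk z₀)).spanFinrank = 4 := by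
    have h := IsRegularLocalRing.spanFinrank_maximalIdeal (R := (Spec (.of S)).presheaf.stalk z₀)
    rw [hdimA] at h
    exact_mod_cast h
  -- the regular system `(x₃, x₀, x₁, x₂)` read in the stalk
  let c : Fin 4 → (Spec (.of S)).presheaf.stalk z₀ := fun i =>
    algebraMap S _ (x (![3, 0, 1, 2] i))
  have hc0 : c 0 = algebraMap S _ (x 3) := rfl
  have hc1 : c 1 = algebraMap S _ (x 0) := rfl
  have hc2 : c 2 = algebraMap S _ (x 1) := rfl
  have hc3 : c 3 = algebraMap S _ (x 2) := rfl
  have hrange : Set.range c = algebraMap S ((Spec (.of S)).presheaf.stalk z₀) '' Set.range x := by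
    ext t
    constructor
    · rintro ⟨i, rfl⟩
      exact ⟨x (![3, 0, 1, 2] i), ⟨_, rfl⟩, rfl⟩
    · rintro ⟨_, ⟨i, rfl⟩, rfl⟩
      fin_cases i
      · exact ⟨1, rfl⟩
      · exact ⟨2, rfl⟩
      · exact ⟨3, rfl⟩
      · exact ⟨0, rfl⟩
  have hc : Ideal.span (Set.range c) = maximalIdeal ((Spec (.of S)).presheaf.stalk z₀) := by
    rw [hrange, ← Ideal.map_span, hx, hmaxA]
  have hJ : stalkIdeal J₀ z₀ = maximalIdeal ((Spec (.of S)).presheaf.stalk z₀) := by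
    rw [hJ₀, DepthTargets.stalkIdeal_idealSheaf_eq, hmaxA]
    rfl
  have hH₀ : stalkIdeal Hq z₀ = Ideal.span {c 1 * c 2 + c 3 ^ 2} := by
    rw [hHq, DepthTargets.stalkIdeal_idealSheaf_eq, Ideal.map_span, Set.image_singleton, map_add, map_mul, map_pow,
      hc1, hc2, hc3]
    rfl
  have hG₀' : stalkIdeal G₀ z₀ = Ideal.span {c 0} := by
    rw [hG₀, DepthTargets.stalkIdeal_idealSheaf_eq, Ideal.map_span, Set.image_singleton, hc0]
    rfl
  -- THE VERTEX FIBRE THEOREM on `Spec S`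
  obtain ⟨z₁, hσz₁, ⟨c', hreg', hc', hd', hE', h𝓗', -⟩, hsnc⟩ := hVF hσ z₀ c hc hdA hJ Hq G₀ hH₀ hG₀'
  have h𝔪 : maximalIdeal S ≠ ⊥ := by
    intro h
    rw [h, Submodule.spanFinrank_bot] at hd
    exact absurd hd (by norm_num)
  haveI : IsProper σ := hσ.isProper
  haveI : IsLocallyNoetherian (blowup J₀) := LocallyOfFiniteType.isLocallyNoetherian σ
  have hsuppJ₀ : ∀ s : Spec (.of S), s ∈ J₀.support → s = IsLocalRing.closedPoint S := fun s hs =>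
    support_idealSheaf_subset_closedPoint (Q := maximalIdeal S) (n := 1) (by rw [pow_one]) s hs
  -- the transform identity for the cone
  have hH : J₀.comap σ ^ 2 * controlledTransform σ J₀ Hq 2 = Hq.comap σ := by
    refine pow_mul_controlledTransform_eq σ J₀ hσ.isEffectiveCartier ?_
    rw [← comap_pow]
    refine Scheme.IdealSheafData.comap_mono σ ?_
    rw [hJ₀, ← DepthOne.idealSheaf_pow]
    refine idealSheaf_mono ?_
    rw [Ideal.span_singleton_le_iff_mem, ← hx, pow_two]
    have hm : ∀ i, x i ∈ Ideal.span (Set.range x) := fun i => Ideal.subset_span ⟨i, rfl⟩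
    exact Ideal.add_mem _ (Ideal.mul_mem_mul (hm 0) (hm 1)) (by rw [pow_two]; exact Ideal.mul_mem_mul (hm 2) (hm 2))
  refine ⟨z₁,
    { isIntegral := hσ.isIntegral (affineBlowup.idealSheaf_ne_bot h𝔪)
      isNoetherian := ?_
      isRegular := ?_
      exists_isBlowup := ⟨J₀, hσ, fun s hs => Set.mem_singleton_iff.mpr (hsuppJ₀ s hs)⟩
      isLocallyPrincipal := hσ.isEffectiveCartier.isLocallyPrincipal.pow 2
      boundaryOf_eq := rfl
      format := ?_
      isClosed := ?_
      apply_eq := hσz₁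
      vertex := ⟨c', hreg', hc', hd', h𝓗', hE'⟩
      not_mem_support := fun D hD => by simp [boundaryOf] at hD
      snc := ?_ }⟩
  · -- Noetherian
    haveI : CompactSpace (blowup J₀) := QuasiCompact.compactSpace_of_compactSpace σ
    exact {}
  · -- regular: blowing up the closed point of the regular scheme `Spec S`
    refine IsBlowup.isRegular_of_isRegular_subscheme (Scheme.isRegular_Spec (.of S)) ?_ hσ
    refine Scheme.isRegular_subscheme_of_forall J₀ fun y hy => ?_
    obtain rfl : y = z₀ := hsuppJ₀ y hy
    rw [hJ]
    letI := Ideal.Quotient.field (maximalIdeal ((Spec (.of S)).presheaf.stalk z₀))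
    infer_instance
  · -- THE FORMAT `I𝒪_{X₁} = 𝓘_{E₁}² · (𝓗₁ ⊔ 𝓘_{E₁}^ℓ)`
    rw [DepthTargets.idealSheaf_sup_eq, DepthOne.idealSheaf_pow, Scheme.IdealSheafData.comap_sup, comap_pow, ← hH,
      List.nil_append, List.nil_append, monomialIdeal_singleton, monomialIdeal_singleton, pow_zero,
      Scheme.IdealSheafData.one_eq_top, Scheme.IdealSheafData.mul_top, ← Scheme.IdealSheafData.add_eq_sup,
      ← Scheme.IdealSheafData.add_eq_sup]
    ring
  · -- the vertex is closed
    refine hσ.isClosed_singleton_of_ringKrullDim_eq (x' := z₁) (by rw [hσz₁]; exact hz₀) ?_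
    rw [hσz₁, ← IsRegularLocalRing.spanFinrank_maximalIdeal, hd', hdimA]
  · -- simple normal crossings off the vertex (every point of `X₁` over the closed point)
    intro x₁ hx₁ hne
    refine (hsnc x₁ hx₁ hne).anti fun D hD _ => ?_
    simp only [boundaryOf, List.map_nil, List.nil_append, List.mem_cons, List.not_mem_nil, or_false] at hD
    rcases hD with rfl | rfl
    · exact List.mem_cons_self
    · exact List.mem_cons_of_mem _ List.mem_cons_self

end LadderState

/-! ## §7 The rung, modulo the vertex fibre theorem -/

variable (x : Fin 4 → S) (hx : Ideal.span (Set.range x) = maximalIdeal S) (hd : (maximalIdeal S).spanFinrank = 4) (ℓ : ℕ)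

include hd in
/-- `μ(𝔪) = 4` forces `𝔪 ≠ 0`. [folklore] -/
theorem maximalIdeal_ne_bot_of_spanFinrank : maximalIdeal S ≠ ⊥ := by
  intro h
  rw [h, Submodule.spanFinrank_bot] at hd
  exact absurd hd (by norm_num)

include hVF hx hd in
/-- **RUNG «r-cone-ℓ» IN COMPANION FORM, modulo the vertex fibre theorem**: `I = (x₀x₁ + x₂²) + 𝔪^{ℓ+2}` has an `𝔪`-primary
companion `Q ⊇ 𝔪^m` with a REGULAR blowing up of `Spec S` along `I · Q` — `(q) + 𝔪^{ℓ+2} ∈ 𝒞` for EVERY `ℓ`.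
[cite: Kollar2007, 3.61 and (3.111) Step 3] [cite: StacksProject, Tag 080A] -/
theorem companion_cone_sup_pow_of :
    ∃ (Q : Ideal S) (m : ℕ), IsLocalRing.maximalIdeal S ^ m ≤ Q ∧
      ∃ (B' : Scheme.{u}) (b : B' ⟶ Spec (.of S)),
        IsBlowup b (affineBlowup.idealSheaf ((Ideal.span {x 0 * x 1 + x 2 ^ 2} ⊔ maximalIdeal S ^ (ℓ + 2)) * Q)) ∧
        Scheme.IsRegular B' := by
  haveI : IsDomain S := isDomain_of_isRegularLocalRing S
  have h𝔪 : maximalIdeal S ≠ ⊥ := maximalIdeal_ne_bot_of_spanFinrank hd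
  have hI : Ideal.span {x 0 * x 1 + x 2 ^ 2} ⊔ maximalIdeal S ^ (ℓ + 2) ≠ ⊥ := fun h =>
    pow_ne_zero (ℓ + 2) h𝔪 (eq_bot_iff.mpr (le_sup_right.trans h.le))
  have hIm : ((affineBlowup.idealSheaf (Ideal.span {x 0 * x 1 + x 2 ^ 2} ⊔ maximalIdeal S ^ (ℓ + 2))).support :
      Set (Spec (.of S))) ⊆ {IsLocalRing.closedPoint S} := fun s hs =>
    Set.mem_singleton_iff.mpr (support_idealSheaf_subset_closedPoint (n := ℓ + 2) le_sup_right s hs)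
  obtain ⟨z₁, h₁⟩ := LadderState.initial hVF x hx hd ℓ
  exact LadderState.companion hVF hI hIm ℓ h₁

include hVF hx hd in
/-- **RUNG «r-cone-ℓ» MODULO THE VERTEX FIBRE THEOREM.**  For `S` regular local with a regular system of parameters `x₀, …, x₃`
and EVERY `ℓ`, every blowing up `T = Bl_I Spec S` of `I = (x₀x₁ + x₂²) + 𝔪^{ℓ+2}` carries a non-zero ideal sheaf cosupported in
the closed fibre whose blowing up is regular (`atomConclusion_of_companion'` on the companion form). Every characteristic, every
residue field, no completeness. [cite: Kollar2007, 3.61 and (3.111) Step 3] [cite: StacksProject, Tag 080A] -/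
theorem coreRung_cone_sup_pow_of (T : Scheme.{u}) (f : T ⟶ Spec (.of S))
    (hf : IsBlowup f (affineBlowup.idealSheaf (Ideal.span {x 0 * x 1 + x 2 ^ 2} ⊔ maximalIdeal S ^ (ℓ + 2)))) :
    ∃ (J : T.IdealSheafData) (T' : Scheme.{u}) (π : T' ⟶ T), J ≠ ⊥ ∧
      (∀ t : T, t ∈ J.support → f.base t = IsLocalRing.closedPoint S) ∧
      IsBlowup π J ∧ Scheme.IsRegular T' := by
  haveI : IsDomain S := isDomain_of_isRegularLocalRing S
  have hI : Ideal.span {x 0 * x 1 + x 2 ^ 2} ⊔ maximalIdeal S ^ (ℓ + 2) ≠ ⊥ := fun h =>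
    pow_ne_zero (ℓ + 2) (maximalIdeal_ne_bot_of_spanFinrank hd) (eq_bot_iff.mpr (le_sup_right.trans h.le))
  exact atomConclusion_of_companion' hI (companion_cone_sup_pow_of hVF x hx hd ℓ) T f hf

include hVF hx hd in
/-- **The Frobenius-shaped member `(x₀^{ℓ+2}, …, x₃^{ℓ+2}, x₀x₁ + x₂²)`** — a sup-reduction of `(q) + 𝔪^{ℓ+2}`
(`(xᵢ^a) · 𝔪^{3a} = 𝔪^{4a}`, r1a's pigeonhole; r1d `coreRung_sup_reduction_of_companion`), modulo the vertex fibre theorem.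
[cite: StacksProject, Tag 080A] -/
theorem coreRung_powersPlus_cone_of (T : Scheme.{u}) (f : T ⟶ Spec (.of S))
    (hf : IsBlowup f (affineBlowup.idealSheaf
      (Ideal.span (Set.range (fun i : Fin 4 => x i ^ (ℓ + 2)) ∪ {x 0 * x 1 + x 2 ^ 2})))) :
    ∃ (J : T.IdealSheafData) (T' : Scheme.{u}) (π : T' ⟶ T), J ≠ ⊥ ∧
      (∀ t : T, t ∈ J.support → f.base t = IsLocalRing.closedPoint S) ∧
      IsBlowup π J ∧ Scheme.IsRegular T' := by
  haveI : IsDomain S := isDomain_of_isRegularLocalRing S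
  have h𝔪 : maximalIdeal S ≠ ⊥ := maximalIdeal_ne_bot_of_spanFinrank hd
  have hx0 : x 0 ≠ 0 := by
    intro h0
    apply Literature.AlgebraicGeometry.Hironaka2017.S06BaseHike.not_mem_maximalIdeal_sq_of_minimal_generators hx hd 0
    rw [h0]; exact zero_mem _
  -- the pigeonhole `(xᵢ^a) · 𝔪^{3a} = 𝔪^{4a}`
  have hred : Ideal.span (Set.range fun i : Fin 4 => x i ^ (ℓ + 2)) * (maximalIdeal S ^ (ℓ + 2)) ^ 3 =
      (maximalIdeal S ^ (ℓ + 2)) ^ (3 + 1) := by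
    rw [← pow_mul, ← pow_mul, show (ℓ + 2) * (3 + 1) = (ℓ + 2) + (ℓ + 2) * 3 by ring,
      CoreRung.span_powers_mul_pow_eq_pow x hx (by omega)]
  have hle : Ideal.span (Set.range fun i : Fin 4 => x i ^ (ℓ + 2)) ≤ maximalIdeal S ^ (ℓ + 2) := by
    rw [Ideal.span_le]
    rintro _ ⟨i, rfl⟩
    exact Ideal.pow_mem_pow (hx ▸ Ideal.subset_span (Set.mem_range_self i)) _
  have hI : Ideal.span {x 0 * x 1 + x 2 ^ 2} ⊔ Ideal.span (Set.range fun i : Fin 4 => x i ^ (ℓ + 2)) ≠ ⊥ :=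
    fun h => pow_ne_zero (ℓ + 2) hx0 ((Submodule.eq_bot_iff _).mp h _
      (Ideal.mem_sup_right (Ideal.subset_span (Set.mem_range_self (f := fun i : Fin 4 => x i ^ (ℓ + 2)) 0))))
  have hKm : IsLocalRing.maximalIdeal S ^ (ℓ + 2) ≤ Ideal.span {x 0 * x 1 + x 2 ^ 2} ⊔ maximalIdeal S ^ (ℓ + 2) :=
    le_sup_right
  rw [Ideal.span_union, sup_comm] at hf
  exact coreRung_sup_reduction_of_companion hle hred hI hKm (companion_cone_sup_pow_of hVF x hx hd ℓ) T f hf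

end Climb

end ConeDepth

end Summit.ResolutionOfSingularities.ResolutionOfSingularities.Theorems

end
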